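import Literature.NumberTheory.LFunctions.WeilConjecturesFatouProofs
import Literature.NumberTheory.LFunctions.WeilConjecturesFactorizationProofs
import Mathlib.FieldTheory.IsAlgClosed.Basic
import Mathlib.FieldTheory.Minpoly.Field
import HarnessLib

/-!
# Deligne's reduction (1.7) ⟹ (1.6) of *La conjecture de Weil. I*

Deligne, *La conjecture de Weil. I*, Publ. Math. IHÉS 43 (1974), Théorème (1.6): for `X₀`
smooth projective over `𝔽_q` and every `i`, `det(1 - F*t, Hⁱ(X, ℚ_ℓ))` has integer coefficients
independent of `ℓ`, and its complex reciprocal roots have absolute value `q^{i/2}`. On pp. 276–277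
Deligne shows that (1.6) follows from the apparently weaker

> **Lemme (1.7).** Pour chaque `i`, et chaque `ℓ ≠ p`, les valeurs propres de l'endomorphisme
> `F*` de `Hⁱ(X, ℚ_ℓ)` sont des nombres algébriques dont tous les conjugués complexes `α` sont de
> valeur absolue `|α| = q^{i/2}`,

the rest of the paper (§§3–7) being the proof of (1.7). This file formalises the reduction
(1.7) ⟹ (1.6) for an arbitrary Weil cohomology theory with Galois action
`E : Literature.AlgebraicGeometry.Motives.GaloisWeilCohomology k K χ` (coefficients `K` of
characteristic zero) satisfying the Lefschetz trace formula, with Lemma (1.7) in the following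
**eigenvalue-free form**: `Pᵢ(T) = det(1 - T·F | Hⁱ(X))` divides in `K[T]` the image of a
polynomial `Rᵢ ∈ ℚ[T]` all of whose complex roots have absolute value `q^{-i/2}`. (Equivalent to
(1.7): `Rᵢ` may be taken to be the reverse of the product of the minimal polynomials over `ℚ` of
the eigenvalues of `F*` — `frobCharPoly_dvd_of_eigenvalues` below; conversely an eigenvalue `α`
satisfies `Rᵢ(α⁻¹) = 0`, so it is algebraic and its complex conjugates have absolute value
`q^{i/2}`.)

Deligne's argument (pp. 276–277) and its formal counterpart:

1. `Z(X₀, t) ∈ ℤ⟦t⟧` with constant term `1` —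
   `WeilFatou.exists_int_map_eq_zetaSeries_of_isSmoothProjective` (`WeilConjecturesFatouProofs`).
2. By (1.5.4) (`GaloisWeilCohomology.zetaSeries_mul_prod_frobCharPoly_holds`), `Z` is rational over
   `ℚ_ℓ`, hence over `ℚ` ("cette nullité [des déterminants de Hankel] est vraie dans `ℚ_ℓ` si et
   seulement si elle l'est dans `ℚ`") — `WeilFunctionalEquation.exists_rat_presentation` (a
   `ℚ`-linear functional in place of Hankel determinants).
3. Write `Z = P/Q₁` with `P, Q₁` coprime ("premiers entre eux"), constant terms `1` —
   `WeilDeligneReduction.exists_isCoprime_presentation`; by (1.7) the `Pᵢ` are pairwise coprime,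
   so the right-hand side of (1.5.4) is in lowest terms and `P ~ ∏_{i odd} Pᵢ`,
   `Q₁ ~ ∏_{i even} Pᵢ` — `WeilDeligneReduction.associated_of_isCoprime_of_mul_eq_mul`.
4. Each `Pᵢ` has rational coefficients (Deligne: the set of roots of `R = PQ₁` all of whose
   complex conjugates have absolute value `q^{-i/2}` is Galois stable) — here in `gcd` form,
   `Pᵢ = gcd(Q₁ or P, Rᵢ)` computed over `ℚ` (`Polynomial.gcd_map`),
   `WeilDeligneReduction.exists_rat_model`.
5. Fatou's lemma (`P, Q₁ ∈ ℤ[t]`) and Gauss's lemma (the divisors `Pᵢ` are integral) —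
   `WeilFatou.exists_int_map_eq_of_isCoprime`, `WeilFatou.exists_int_map_eq_of_dvd`.

Independence of `ℓ` in (1.6) ("La description ci-dessus des racines de `Pᵢ(t)` est indépendante
de `ℓ`", p. 277) is, in this formalism, the uniqueness of Weil factorisations of `Z(X, T)`
(`IsWeilFactorization.unique`): the integral models for two Galois Weil cohomology theories with
the trace formula coincide (`integralModel_eq_of_weilRiemannHypothesis`).

## Main results

* `WeilDeligneReduction.exists_int_model`: the abstract reduction — integral models dividing the
  `Rᵢ` for polynomials `Pᵢ ∈ L[T]`, `Pᵢ(0) = 1`, with `Z · ∏_{even} Pᵢ = ∏_{odd} Pᵢ`,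
  `Z ∈ ℤ⟦T⟧`, `Pᵢ ∣ Rᵢ`, `Rᵢ ∈ ℚ[T]` pairwise coprime.
* `weilRiemannHypothesisFor_of_frobCharPoly_dvd`: (1.7) ⟹ (1.6) for `E` and a smooth projective
  `X`: `E.WeilRiemannHypothesisFor X n`.
* `WeilDeligneReduction.exists_reverse_dvd_of_roots`, `frobCharPoly_dvd_of_eigenvalues`,
  `weilRiemannHypothesisFor_of_eigenvalues`: Lemma (1.7) *as printed* (every eigenvalue of `F*`
  on `Hⁱ`, i.e. every root of the characteristic polynomial in an algebraically closed
  `L ⊇ K`, is algebraic over `ℚ` with all complex conjugates of absolute value `q^{i/2}`)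
  implies the eigenvalue-free form, and hence (1.6).
* `IsWeilFactorization.unique`, `integralModel_eq_of_weilRiemannHypothesis`: Weil
  factorisations of a given `Z` are unique (`q > 1`), hence the integral models of the
  `det(1 - T·F | Hⁱ(X))` do not depend on the cohomology theory — the clause "à coefficients
  entiers indépendants de `ℓ`" of Théorème (1.6).
* `deligneWeilIStatement_of_frobCharPoly_dvd`: (1.7) for all `X` ⟹ `DeligneWeilIStatement E`.
* `exists_isWeilFactorization_of_frobCharPoly_dvd`,
  `exists_isWeilFactorization_of_forall_prime_of_frobCharPoly_dvd`: the named fact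
  `Literature.NumberTheory.LFunctions.exists_isWeilFactorization` from the cohomological
  formalism (trace formula, `χ(φ) = q`) and Lemma (1.7), resp. from the existence of `ℓ`-adic
  cohomology with the trace formula and Lemma (1.7) — sharpening
  `exists_isWeilFactorization_of_forall_prime` (`WeilConjecturesFactorizationProofs`), whose
  input was Theorem (1.6) itself.

## References

* P. Deligne, *La conjecture de Weil. I*, Publ. Math. IHÉS 43 (1974), 273–307: (1.5.4),
  Théorème (1.6), Lemme (1.7) and "Preuve de (1.7) ⟹ (1.6)", pp. 276–277. [Deligne1974]
* R. Hartshorne, *Algebraic Geometry* (1977), App. C, Thm. 4.2 and the remark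
  `ℚ⟦t⟧ ∩ ℚ_ℓ(t) = ℚ(t)`. [Hartshorne1977]

## Design notes

* No definitions; helpers live in `namespace Literature.NumberTheory.LFunctions.WeilDeligneReduction`.
  The hypothesis "(1.7) in eigenvalue-free form" is spelled out in each statement rather than
  abbreviated by a `def`.
* The abstract reduction is stated over an arbitrary field `L` of characteristic zero in place of
  `ℚ_ℓ`, for families `P, R : ℕ → _` indexed by `Finset.range N` and split by parity, matching
  `GaloisWeilCohomology.zetaSeries_mul_prod_frobCharPoly`.
-/

universe u v

open Polynomial

noncomputable section

namespace Literature.NumberTheory.LFunctions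

namespace WeilDeligneReduction

/-! ### Polynomial algebra over a field -/

section Algebra

variable {K : Type*} [Field K]

/-- Two associated polynomials over a field with the same non-zero constant term are equal.
[folklore] -/
theorem eq_of_associated_of_coeff_zero_eq {p q : K[X]} (h : Associated p q)
    (h0 : p.coeff 0 = q.coeff 0) (hq : q.coeff 0 ≠ 0) : p = q := by
  obtain ⟨u, hu⟩ := h
  obtain ⟨r, -, hru⟩ := Polynomial.isUnit_iff.mp u.isUnit
  have h1 : q.coeff 0 * r = q.coeff 0 * 1 := by
    rw [mul_one]
    conv_rhs => rw [← hu, ← hru, mul_coeff_zero, coeff_C_zero, h0]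
  rw [← hu, ← hru, mul_left_cancel₀ hq h1, C_1, mul_one]

/-- The constant term of a polynomial associated to one with non-zero constant term is non-zero.
[folklore] -/
theorem coeff_zero_ne_zero_of_associated {p q : K[X]} (h : Associated p q) (hq : q.coeff 0 ≠ 0) :
    p.coeff 0 ≠ 0 := by
  obtain ⟨u, hu⟩ := h
  obtain ⟨r, -, hru⟩ := Polynomial.isUnit_iff.mp u.isUnit
  intro hp
  apply hq
  rw [← hu, ← hru, mul_coeff_zero, hp, zero_mul]

/-- If `a e = b o` with `a, b` coprime and `e, o` coprime then `a ~ o` and `b ~ e`. [folklore] -/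
theorem associated_of_isCoprime_of_mul_eq_mul {a b e o : K[X]} (hab : IsCoprime a b)
    (heo : IsCoprime e o) (h : a * e = b * o) : Associated a o ∧ Associated b e := by
  refine ⟨associated_of_dvd_dvd ?_ ?_, associated_of_dvd_dvd ?_ ?_⟩
  · exact hab.dvd_of_dvd_mul_left ⟨e, h.symm⟩
  · exact heo.symm.dvd_of_dvd_mul_left ⟨b, by rw [mul_comm, h, mul_comm]⟩
  · exact hab.symm.dvd_of_dvd_mul_left ⟨o, h⟩
  · exact heo.dvd_of_dvd_mul_left ⟨a, by rw [mul_comm, ← h, mul_comm]⟩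

/-- Making a rational presentation reduced: if `Z · b = a` in `K⟦T⟧` with `b(0) ≠ 0`, then also
`Z · b' = a'` with `a', b'` coprime and `b'(0) = 1` (divide by `gcd(a, b)` and normalise; Deligne,
*Weil I*, p. 276: "Écrivons `Z(X₀, t) = P/Q₁`, avec `P, Q₁` … premiers entre eux"). [folklore] -/
theorem exists_isCoprime_presentation {Z : PowerSeries K} {a b : K[X]} (hb0 : b.coeff 0 ≠ 0)
    (hZ : Z * (b : PowerSeries K) = a) :
    ∃ a' b' : K[X], IsCoprime a' b' ∧ b'.coeff 0 = 1 ∧ Z * (b' : PowerSeries K) = a' := by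
  classical
  obtain ⟨g, hg⟩ : ∃ g, EuclideanDomain.gcd a b = g := ⟨_, rfl⟩
  have hb : b ≠ 0 := fun h => hb0 (by rw [h, coeff_zero])
  have hg0 : g ≠ 0 := fun h => hb (EuclideanDomain.gcd_eq_zero_iff.mp (hg.trans h)).2
  obtain ⟨a₁, ha₁⟩ : g ∣ a := hg ▸ EuclideanDomain.gcd_dvd_left a b
  obtain ⟨b₁, hb₁⟩ : g ∣ b := hg ▸ EuclideanDomain.gcd_dvd_right a b
  -- Bézout: `g = a x + b y = g (a₁ x + b₁ y)`, so `a₁ x + b₁ y = 1`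
  have hcop : IsCoprime a₁ b₁ := by
    refine ⟨EuclideanDomain.gcdA a b, EuclideanDomain.gcdB a b, mul_left_cancel₀ hg0 ?_⟩
    have h := EuclideanDomain.gcd_eq_gcd_ab a b
    rw [hg] at h
    calc g * (EuclideanDomain.gcdA a b * a₁ + EuclideanDomain.gcdB a b * b₁)
        = g * a₁ * EuclideanDomain.gcdA a b + g * b₁ * EuclideanDomain.gcdB a b := by ring
      _ = g := by rw [← ha₁, ← hb₁, ← h]
      _ = g * 1 := (mul_one g).symm
  have hb₁0 : b₁.coeff 0 ≠ 0 := by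
    rw [hb₁, mul_coeff_zero] at hb0
    exact right_ne_zero_of_mul hb0
  have hZ₁ : Z * (b₁ : PowerSeries K) = a₁ := by
    apply mul_left_cancel₀ (mt Polynomial.coe_eq_zero_iff.mp hg0)
    rw [mul_left_comm, ← Polynomial.coe_mul, ← hb₁, hZ, ha₁, Polynomial.coe_mul]
  have hcu : IsUnit (C (b₁.coeff 0)⁻¹) := isUnit_C.mpr (inv_ne_zero hb₁0).isUnit
  refine ⟨a₁ * C (b₁.coeff 0)⁻¹, b₁ * C (b₁.coeff 0)⁻¹, (isCoprime_mul_unit_right hcu _ _).mpr hcop,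
    ?_, ?_⟩
  · rw [coeff_mul_C, mul_inv_cancel₀ hb₁0]
  · rw [Polynomial.coe_mul, Polynomial.coe_mul, ← mul_assoc, hZ₁]

/-- Polynomials over `ℚ` whose complex roots lie on circles of different radii are coprime
(Deligne, *Weil I*, p. 277: "D'après l'hypothèse (1.7), les `Pᵢ` sont premiers entre eux").
[cite: Deligne1974, p. 277] -/
theorem isCoprime_of_norm_roots {R₁ R₂ : ℚ[X]} {r₁ r₂ : ℝ} (hr : r₁ ≠ r₂)
    (h₁ : ∀ z : ℂ, (R₁.map (algebraMap ℚ ℂ)).IsRoot z → ‖z‖ = r₁)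
    (h₂ : ∀ z : ℂ, (R₂.map (algebraMap ℚ ℂ)).IsRoot z → ‖z‖ = r₂) : IsCoprime R₁ R₂ := by
  refine (Polynomial.isCoprime_iff_aeval_ne_zero_of_isAlgClosed (k := ℚ) (K := ℂ) R₁ R₂).mpr
    fun z => ?_
  by_contra h
  push Not at h
  exact hr ((h₁ z (by rw [IsRoot, eval_map_algebraMap, h.1])).symm.trans
    (h₂ z (by rw [IsRoot, eval_map_algebraMap, h.2])))

/-- `q^{-i/2} = q^{-j/2}` forces `i = j` for `q > 1`. [folklore] -/
theorem eq_of_rpow_neg_half_eq {q : ℕ} (hq : 1 < q) {i j : ℕ}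
    (h : (q : ℝ) ^ (-(i : ℝ) / 2) = (q : ℝ) ^ (-(j : ℝ) / 2)) : i = j := by
  have hq0 : (0 : ℝ) < q := by exact_mod_cast zero_lt_one.trans hq
  have hq1 : (q : ℝ) ≠ 1 := by exact_mod_cast hq.ne'
  have h' := (Real.rpow_right_inj hq0 hq1).mp h
  have : (i : ℝ) = j := by linarith
  exact_mod_cast this

end Algebra

/-! ### Rational and integral models -/

section Models

variable {L : Type*} [Field L] [CharZero L]

/-- **The rational model of each `Pᵢ`** (Deligne, *Weil I*, p. 277, in `gcd` form). Let
`c ∈ ℚ[T]` become associated over `L ⊇ ℚ` to a product `∏_{j ∈ s} Pⱼ` of polynomials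
`Pⱼ ∈ L[T]` with `Pⱼ(0) = 1`, where each `Pⱼ` divides (the image of) some `Rⱼ ∈ ℚ[T]` and the
`Rⱼ` are pairwise coprime. Then each `Pᵢ` is defined over `ℚ`: `Pᵢ` is the image of
`Qᵢ = gcd(c, Rᵢ)` (normalised to `Qᵢ(0) = 1`), because `gcd` commutes with extension of scalars
(Mathlib `Polynomial.gcd_map`) and `gcd(∏ Pⱼ, Rᵢ) ~ Pᵢ` by coprimality. (Deligne phrases this with
the Galois-stable set of roots of `R = PQ₁` of absolute value `q^{-i/2}`.) [cite: Deligne1974, p. 277] -/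
theorem exists_rat_model (s : Finset ℕ) {P : ℕ → L[X]} {R : ℕ → ℚ[X]} {c : ℚ[X]}
    (hc : Associated (c.map (algebraMap ℚ L)) (∏ j ∈ s, P j))
    (hPR : ∀ j ∈ s, P j ∣ (R j).map (algebraMap ℚ L))
    (hR : ∀ i ∈ s, ∀ j ∈ s, i ≠ j → IsCoprime (R i) (R j))
    (hP0 : ∀ j ∈ s, (P j).coeff 0 = 1) {i : ℕ} (hi : i ∈ s) :
    ∃ Q : ℚ[X], Q.map (algebraMap ℚ L) = P i ∧ Q.coeff 0 = 1 ∧ Q ∣ R i ∧ Q ∣ c := by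
  classical
  obtain ⟨g, hg⟩ : ∃ g, EuclideanDomain.gcd c (R i) = g := ⟨_, rfl⟩
  have hg_c : g ∣ c := hg ▸ EuclideanDomain.gcd_dvd_left c (R i)
  have hg_R : g ∣ R i := hg ▸ EuclideanDomain.gcd_dvd_right c (R i)
  have hgmap : EuclideanDomain.gcd (c.map (algebraMap ℚ L)) ((R i).map (algebraMap ℚ L)) =
      g.map (algebraMap ℚ L) := by
    rw [Polynomial.gcd_map, hg]
  -- `Pᵢ ∣ g` over `L`
  have h1 : P i ∣ g.map (algebraMap ℚ L) := by
    rw [← hgmap]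
    exact EuclideanDomain.dvd_gcd (hc.dvd_iff_dvd_right.mpr (Finset.dvd_prod_of_mem P hi))
      (hPR i hi)
  -- `g ∣ Pᵢ` over `L`: `g ∣ c ~ Pᵢ · ∏_{j ≠ i} Pⱼ` and `g` is coprime to the `Pⱼ`, `j ≠ i`
  have hcop : IsCoprime (g.map (algebraMap ℚ L)) (∏ j ∈ s.erase i, P j) := by
    refine IsCoprime.prod_right fun j hj => ?_
    obtain ⟨hji, hjs⟩ := Finset.mem_erase.mp hj
    have hRij : IsCoprime ((R i).map (algebraMap ℚ L)) ((R j).map (algebraMap ℚ L)) :=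
      (hR i hi j hjs (Ne.symm hji)).map (mapRingHom (algebraMap ℚ L))
    exact (hRij.of_isCoprime_of_dvd_left (Polynomial.map_dvd _ hg_R)).of_isCoprime_of_dvd_right
      (hPR j hjs)
  have h2 : g.map (algebraMap ℚ L) ∣ P i := by
    refine hcop.dvd_of_dvd_mul_right ?_
    rw [Finset.mul_prod_erase s P hi]
    exact hc.dvd_iff_dvd_right.mp (Polynomial.map_dvd _ hg_c)
  have hassoc : Associated (g.map (algebraMap ℚ L)) (P i) := associated_of_dvd_dvd h2 h1
  have hPi0 : (P i).coeff 0 ≠ 0 := by rw [hP0 i hi]; exact one_ne_zero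
  have hg0 : g.coeff 0 ≠ 0 := by
    have h := coeff_zero_ne_zero_of_associated hassoc hPi0
    rwa [coeff_map, _root_.map_ne_zero] at h
  -- normalise the constant term
  refine ⟨g * C (g.coeff 0)⁻¹, ?_, ?_, ?_, ?_⟩
  · have hu : IsUnit (C ((algebraMap ℚ L) (g.coeff 0)⁻¹)) :=
      isUnit_C.mpr (by rw [map_inv₀]; exact (inv_ne_zero ((_root_.map_ne_zero _).mpr hg0)).isUnit)
    refine eq_of_associated_of_coeff_zero_eq ?_ ?_ hPi0
    · rw [Polynomial.map_mul, map_C]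
      exact (associated_mul_unit_left _ _ hu).trans hassoc
    · rw [Polynomial.map_mul, map_C, coeff_mul_C, coeff_map, ← map_mul, mul_inv_cancel₀ hg0,
        map_one, hP0 i hi]
  · rw [coeff_mul_C, mul_inv_cancel₀ hg0]
  · exact (Dvd.intro (C (g.coeff 0)) (by
      rw [mul_assoc, ← C_mul, inv_mul_cancel₀ hg0, C_1, mul_one])).trans hg_R
  · exact (Dvd.intro (C (g.coeff 0)) (by
      rw [mul_assoc, ← C_mul, inv_mul_cancel₀ hg0, C_1, mul_one])).trans hg_c

/-- Constant terms of integer lifts. [folklore] -/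
theorem coeff_zero_eq_one_of_map {A : ℤ[X]} {a : ℚ[X]} (hA : A.map (Int.castRingHom ℚ) = a)
    (ha : a.coeff 0 = 1) : A.coeff 0 = 1 := by
  apply Int.cast_injective (α := ℚ)
  have h := congrArg (fun p : ℚ[X] => p.coeff 0) hA
  simp only [coeff_map, eq_intCast] at h
  rw [h, ha, Int.cast_one]

/-- **Deligne's reduction (1.7) ⟹ (1.6), abstract form** (Deligne, *La conjecture de Weil. I*,
pp. 276–277). Let `Z ∈ ℚ⟦T⟧` have integer coefficients and constant term `1`, let `L ⊇ ℚ` be a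
field and `P₀, …, P_{N-1} ∈ L[T]` polynomials with `Pᵢ(0) = 1` such that
`Z · ∏_{i even} Pᵢ = ∏_{i odd} Pᵢ` in `L⟦T⟧` (the cohomological expression (1.5.4)), and suppose
(the eigenvalue-free form of Lemma (1.7)) that each `Pᵢ` divides the image of a polynomial
`Rᵢ ∈ ℚ[T]`, the `Rᵢ` being pairwise coprime (e.g. because the complex roots of `Rᵢ` all have
absolute value `q^{-i/2}`). Then every `Pᵢ` has an *integral model* `Qᵢ ∈ ℤ[T]`,
`Qᵢ ↦ Pᵢ` under `ℤ[T] → L[T]`, which moreover divides `Rᵢ` (so that its complex roots are among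
those of `Rᵢ`). Proof, following Deligne: `Z ∈ ℚ(T)` since it is rational over `L`
(`WeilFunctionalEquation.exists_rat_presentation`, in place of Hankel determinants); write
`Z = a/b` with `a, b ∈ ℚ[T]` coprime, `b(0) = 1` (`exists_isCoprime_presentation`); over `L`,
`a · ∏_{even} Pᵢ = b · ∏_{odd} Pᵢ` with both pairs coprime, so `a ~ ∏_{odd} Pᵢ` and
`b ~ ∏_{even} Pᵢ` ("le membre de droite de (1.5.4) est donc sous forme irréductible");
each `Pᵢ` is then defined over `ℚ` (`exists_rat_model`); by Fatou's lemma `a, b ∈ ℤ[T]`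
(`WeilFatou.exists_int_map_eq_of_isCoprime`) and by Gauss's lemma the divisors `Qᵢ` of `a`
or `b` are integral (`WeilFatou.exists_int_map_eq_of_dvd`). [cite: Deligne1974, (1.7) ⟹ (1.6), pp. 276–277] -/
theorem exists_int_model {Z : PowerSeries ℚ}
    (hZi : ∃ Zℤ : PowerSeries ℤ, Zℤ.map (Int.castRingHom ℚ) = Z)
    (hZ0 : PowerSeries.constantCoeff Z = 1) (N : ℕ) {P : ℕ → L[X]}
    (hP0 : ∀ i ∈ Finset.range N, (P i).coeff 0 = 1)
    (hZP : Z.map (algebraMap ℚ L) *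
        ((∏ i ∈ (Finset.range N).filter Even, P i : L[X]) : PowerSeries L) =
      ((∏ i ∈ (Finset.range N).filter Odd, P i : L[X]) : PowerSeries L))
    {R : ℕ → ℚ[X]} (hPR : ∀ i ∈ Finset.range N, P i ∣ (R i).map (algebraMap ℚ L))
    (hR : ∀ i ∈ Finset.range N, ∀ j ∈ Finset.range N, i ≠ j → IsCoprime (R i) (R j))
    {i : ℕ} (hi : i ∈ Finset.range N) :
    ∃ Q : ℤ[X], Q.map (Int.castRingHom L) = P i ∧ Q.map (Int.castRingHom ℚ) ∣ R i := by
  classical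
  have hE0 : (∏ i ∈ (Finset.range N).filter Even, P i).coeff 0 ≠ 0 := by
    rw [coeff_zero_prod, Finset.prod_eq_one (fun j hj => hP0 j (Finset.mem_filter.mp hj).1)]
    exact one_ne_zero
  -- Step 1: `Z ∈ ℚ(T)`, in reduced form `Z = a/b`, `b(0) = 1`
  obtain ⟨a₀, b₀, hb₀, hZ₀⟩ := WeilFunctionalEquation.exists_rat_presentation hE0 hZP
  obtain ⟨a, b, hab, hb1, hZab⟩ := exists_isCoprime_presentation hb₀ hZ₀
  have ha1 : a.coeff 0 = 1 := by
    have h := congrArg PowerSeries.constantCoeff hZab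
    rw [map_mul, hZ0, one_mul, Polynomial.constantCoeff_coe, Polynomial.constantCoeff_coe, hb1] at h
    exact h.symm
  -- Step 2: over `L`, `a ∏_{even} Pᵢ = b ∏_{odd} Pᵢ`, whence `a ~ ∏_{odd}`, `b ~ ∏_{even}`
  have hEO : IsCoprime (∏ i ∈ (Finset.range N).filter Even, P i)
      (∏ i ∈ (Finset.range N).filter Odd, P i) := by
    refine IsCoprime.prod_left fun i hi => IsCoprime.prod_right fun j hj => ?_
    obtain ⟨hi, hie⟩ := Finset.mem_filter.mp hi
    obtain ⟨hj, hjo⟩ := Finset.mem_filter.mp hj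
    have hij : i ≠ j := fun h => (Nat.not_odd_iff_even.mpr hie) (h ▸ hjo)
    exact (((hR i hi j hj hij).map (mapRingHom (algebraMap ℚ L))).of_isCoprime_of_dvd_left
      (hPR i hi)).of_isCoprime_of_dvd_right (hPR j hj)
  have hZL : Z.map (algebraMap ℚ L) * (b.map (algebraMap ℚ L) : PowerSeries L) =
      (a.map (algebraMap ℚ L) : PowerSeries L) := by
    rw [Polynomial.polynomial_map_coe, Polynomial.polynomial_map_coe, ← map_mul, hZab]
  have hx : a.map (algebraMap ℚ L) * (∏ i ∈ (Finset.range N).filter Even, P i) =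
      b.map (algebraMap ℚ L) * ∏ i ∈ (Finset.range N).filter Odd, P i := by
    apply Polynomial.coe_injective
    rw [Polynomial.coe_mul, Polynomial.coe_mul, ← hZP, ← hZL]
    ring
  obtain ⟨haO, hbE⟩ :=
    associated_of_isCoprime_of_mul_eq_mul (hab.map (mapRingHom (algebraMap ℚ L))) hEO hx
  -- Step 3 (Fatou): `a, b ∈ ℤ[T]`
  obtain ⟨Zℤ, hZℤ⟩ := hZi
  obtain ⟨A, B, hA, hB⟩ := WeilFatou.exists_int_map_eq_of_isCoprime hab hb1 (by rw [hZℤ, hZab])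
  have hA1 : A.coeff 0 = 1 := coeff_zero_eq_one_of_map hA ha1
  have hB1 : B.coeff 0 = 1 := coeff_zero_eq_one_of_map hB hb1
  -- Step 4: `Pᵢ` is defined over `ℚ`, by a divisor `Qr` of `Rᵢ` and of `a` or `b`
  have key : ∃ Qr : ℚ[X], Qr.map (algebraMap ℚ L) = P i ∧ Qr.coeff 0 = 1 ∧ Qr ∣ R i ∧
      (Qr ∣ a ∨ Qr ∣ b) := by
    rcases Nat.even_or_odd i with he | ho
    · obtain ⟨Qr, h1, h2, h3, h4⟩ := exists_rat_model ((Finset.range N).filter Even) hbE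
        (fun j hj => hPR j (Finset.mem_filter.mp hj).1)
        (fun i hi j hj => hR i (Finset.mem_filter.mp hi).1 j (Finset.mem_filter.mp hj).1)
        (fun j hj => hP0 j (Finset.mem_filter.mp hj).1) (Finset.mem_filter.mpr ⟨hi, he⟩)
      exact ⟨Qr, h1, h2, h3, Or.inr h4⟩
    · obtain ⟨Qr, h1, h2, h3, h4⟩ := exists_rat_model ((Finset.range N).filter Odd) haO
        (fun j hj => hPR j (Finset.mem_filter.mp hj).1)
        (fun i hi j hj => hR i (Finset.mem_filter.mp hi).1 j (Finset.mem_filter.mp hj).1)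
        (fun j hj => hP0 j (Finset.mem_filter.mp hj).1) (Finset.mem_filter.mpr ⟨hi, ho⟩)
      exact ⟨Qr, h1, h2, h3, Or.inl h4⟩
  obtain ⟨Qr, hQP, hQ1, hQR, hQab⟩ := key
  -- Step 5 (Gauss): `Qr ∈ ℤ[T]`
  have hQint : ∃ Q : ℤ[X], Q.map (Int.castRingHom ℚ) = Qr := by
    rcases hQab with h | h
    · exact WeilFatou.exists_int_map_eq_of_dvd hA1 hQ1 (by rw [hA]; exact h)
    · exact WeilFatou.exists_int_map_eq_of_dvd hB1 hQ1 (by rw [hB]; exact h)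
  obtain ⟨Q, hQ⟩ := hQint
  refine ⟨Q, ?_, by rw [hQ]; exact hQR⟩
  rw [← hQP, ← hQ, Polynomial.map_map]
  congr 1
  exact RingHom.ext_int _ _

/-! ### Lemma (1.7) as printed: eigenvalues and their complex conjugates -/

/-- **Lemma (1.7) as printed implies its eigenvalue-free form.** Let `p ∈ K[T]` be monic (the
characteristic polynomial of `F* | Hⁱ`) and `L ⊇ K` algebraically closed. Suppose every root `α`
of `p` in `L` (every eigenvalue) is algebraic over `ℚ` and all complex roots of its minimal
polynomial over `ℚ` (its "complex conjugates") have absolute value `r` (Deligne, *Weil I*,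
Lemme (1.7): "des nombres algébriques dont tous les conjugués complexes `α` sont de valeur
absolue `|α| = q^{i/2}`"). Then `p^rev = det(1 - T·F)` divides the image of a polynomial
`R ∈ ℚ[T]` all of whose complex roots have absolute value `r⁻¹`: take `R = M^rev` where `M` is
the product, over the roots of `p` with multiplicity, of their minimal polynomials.
[cite: Deligne1974, Lemme (1.7)] -/
theorem exists_reverse_dvd_of_roots {K L : Type*} [Field K] [CharZero K] [Field L] [CharZero L]
    [Algebra K L] [IsAlgClosed L] {p : K[X]} (hp : p.Monic) {r : ℝ}
    (h : ∀ α : L, (p.map (algebraMap K L)).IsRoot α →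
      IsIntegral ℚ α ∧ ∀ z : ℂ, ((minpoly ℚ α).map (algebraMap ℚ ℂ)).IsRoot z → ‖z‖ = r) :
    ∃ R : ℚ[X], p.reverse ∣ R.map (algebraMap ℚ K) ∧
      ∀ z : ℂ, (R.map (algebraMap ℚ ℂ)).IsRoot z → ‖z‖ = r⁻¹ := by
  classical
  have hmL : (p.map (algebraMap K L)).Monic := hp.map _
  have hprod : p.map (algebraMap K L) = ((p.map (algebraMap K L)).roots.map (X - C ·)).prod :=
    (IsAlgClosed.splits _).eq_prod_roots_of_monic hmL
  obtain ⟨s, hs⟩ : ∃ s, (p.map (algebraMap K L)).roots = s := ⟨_, rfl⟩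
  have hmem : ∀ α ∈ s, (p.map (algebraMap K L)).IsRoot α := fun α hα =>
    (mem_roots hmL.ne_zero).mp (hs ▸ hα)
  obtain ⟨M, hM⟩ : ∃ M : ℚ[X], (s.map (minpoly ℚ)).prod = M := ⟨_, rfl⟩
  have hMmonic : M.Monic :=
    hM ▸ monic_multiset_prod_of_monic _ _ fun α hα => minpoly.monic (h α (hmem α hα)).1
  -- `p ∣ M` over `L`, root by root
  have hdvdL : p.map (algebraMap K L) ∣ M.map (algebraMap ℚ L) := by
    rw [hprod, hs, ← hM, Polynomial.map_multiset_prod, Multiset.map_map]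
    refine Multiset.prod_dvd_prod_of_dvd _ _ fun α hα => ?_
    show X - C α ∣ (minpoly ℚ α).map (algebraMap ℚ L)
    rw [dvd_iff_isRoot, IsRoot, eval_map_algebraMap, minpoly.aeval]
  -- hence over `K`
  have hdvdK : p ∣ M.map (algebraMap ℚ K) := by
    rw [← Polynomial.map_dvd_map (algebraMap K L) (algebraMap K L).injective hp,
      Polynomial.map_map, Subsingleton.elim ((algebraMap K L).comp (algebraMap ℚ K)) (algebraMap ℚ L)]
    exact hdvdL
  refine ⟨M.reverse, ?_, fun z hz => ?_⟩
  · rw [← WeilFatou.reverse_map_of_injective (algebraMap ℚ K).injective]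
    obtain ⟨c, hc⟩ := hdvdK
    exact ⟨c.reverse, by rw [hc, reverse_mul_of_domain]⟩
  · rw [← WeilFatou.reverse_map_of_injective (algebraMap ℚ ℂ).injective] at hz
    have hMC : (M.map (algebraMap ℚ ℂ)).Monic := hMmonic.map _
    have hz0 : z ≠ 0 := by
      rintro rfl
      rw [IsRoot, ← coeff_zero_eq_eval_zero, coeff_zero_reverse, hMC.leadingCoeff] at hz
      exact one_ne_zero hz
    -- `z⁻¹` is a root of `M`, hence of the minimal polynomial of some root `α` of `p`
    have hz' : (M.map (algebraMap ℚ ℂ)).IsRoot z⁻¹ := by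
      haveI : Invertible z⁻¹ := invertibleOfNonzero (inv_ne_zero hz0)
      have key := eval₂_reverse_eq_zero_iff (RingHom.id ℂ) z⁻¹ (M.map (algebraMap ℚ ℂ))
      rw [invOf_eq_inv, inv_inv, eval₂_id, eval₂_id] at key
      exact key.mp hz
    rw [← hM, Polynomial.map_multiset_prod, Multiset.map_map, IsRoot, eval_multiset_prod,
      Multiset.map_map, Multiset.prod_eq_zero_iff, Multiset.mem_map] at hz'
    obtain ⟨α, hα, hα0⟩ := hz'
    have hn := (h α (hmem α hα)).2 z⁻¹ hα0
    rw [norm_inv] at hn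
    rw [← inv_inv ‖z‖, hn]

end Models

/-! ### Uniqueness of Weil factorisations ("à coefficients entiers indépendants de `ℓ`") -/

section Unique

open Literature.AlgebraicGeometry.Motives (IsWeilFactorization)

/-- Changing coefficients `ℤ → ℚ → ℂ` is changing coefficients `ℤ → ℂ`. [folklore] -/
theorem map_map_int_rat_complex (P : ℤ[X]) :
    (P.map (Int.castRingHom ℚ)).map (algebraMap ℚ ℂ) = P.map (Int.castRingHom ℂ) := by
  rw [Polynomial.map_map]
  exact congrArg (fun φ : ℤ →+* ℂ => P.map φ) (RingHom.ext_int _ _)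

/-- Divisibility factor by factor: if `∏_{i ∈ s} Fᵢ ∣ H · ∏_{j ∈ s} Gⱼ` where `Fᵢ` is coprime to
`H` and to the `Gⱼ`, `j ≠ i`, then `Fᵢ ∣ Gᵢ`. [folklore] -/
theorem dvd_of_prod_dvd_mul_prod {R : Type*} [CommRing R] {ι : Type*} [DecidableEq ι] (s : Finset ι)
    {F G : ι → R} {H : R} (hFG : ∀ i ∈ s, ∀ j ∈ s, i ≠ j → IsCoprime (F i) (G j))
    (hFH : ∀ i ∈ s, IsCoprime (F i) H) (hdvd : ∏ i ∈ s, F i ∣ H * ∏ j ∈ s, G j) {i : ι}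
    (hi : i ∈ s) : F i ∣ G i := by
  have h1 : F i ∣ (H * ∏ j ∈ s.erase i, G j) * G i := by
    rw [mul_assoc, Finset.prod_erase_mul s G hi]
    exact (Finset.dvd_prod_of_mem F hi).trans hdvd
  refine IsCoprime.dvd_of_dvd_mul_left ?_ h1
  exact (hFH i hi).mul_right (IsCoprime.prod_right fun j hj =>
    hFG i hi j (Finset.mem_erase.mp hj).2 (Ne.symm (Finset.mem_erase.mp hj).1))

/-- The algebra of uniqueness: if `∏_{i ∈ s₁} Fᵢ · ∏_{j ∈ s₂} Gⱼ = ∏_{i ∈ s₁} Gᵢ · ∏_{j ∈ s₂} Fⱼ`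
for families `F`, `G` of polynomials over a field, any two members of `F ∪ G` with different
indices being coprime, `s₁`, `s₂` disjoint, and `Fᵢ(0) = Gᵢ(0) ≠ 0`, then `Fᵢ = Gᵢ` on `s₁ ∪ s₂`.
[folklore] -/
theorem eq_of_prod_mul_prod_eq {K : Type*} [Field K] {ι : Type*} [DecidableEq ι] (s₁ s₂ : Finset ι)
    {F G : ι → K[X]} (hFG : ∀ i j, i ≠ j → IsCoprime (F i) (G j))
    (hF : ∀ i j, i ≠ j → IsCoprime (F i) (F j)) (hG : ∀ i j, i ≠ j → IsCoprime (G i) (G j))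
    (hs : ∀ i ∈ s₁, ∀ j ∈ s₂, i ≠ j)
    (hx : (∏ i ∈ s₁, F i) * ∏ j ∈ s₂, G j = (∏ i ∈ s₁, G i) * ∏ j ∈ s₂, F j)
    (h0 : ∀ i, (F i).coeff 0 = (G i).coeff 0) (h0' : ∀ i, (G i).coeff 0 ≠ 0) {i : ι}
    (hi : i ∈ s₁ ∨ i ∈ s₂) : F i = G i := by
  have hGF : ∀ i j, i ≠ j → IsCoprime (G i) (F j) := fun i j hij => (hFG j i hij.symm).symm
  refine eq_of_associated_of_coeff_zero_eq (associated_of_dvd_dvd ?_ ?_) (h0 i) (h0' i)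
  · rcases hi with hi | hi
    · refine dvd_of_prod_dvd_mul_prod s₁ (H := ∏ j ∈ s₂, F j) (fun i _ j _ hij => hFG i j hij)
        (fun i hi => IsCoprime.prod_right fun j hj => hF i j (hs i hi j hj)) ?_ hi
      exact Dvd.intro _ (by rw [hx, mul_comm])
    · refine dvd_of_prod_dvd_mul_prod s₂ (H := ∏ j ∈ s₁, F j) (fun i _ j _ hij => hFG i j hij)
        (fun i hi => IsCoprime.prod_right fun j hj => hF i j (Ne.symm (hs j hj i hi))) ?_ hi
      exact Dvd.intro (∏ j ∈ s₁, G j) (by rw [mul_comm, ← hx, mul_comm])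
  · rcases hi with hi | hi
    · refine dvd_of_prod_dvd_mul_prod s₁ (H := ∏ j ∈ s₂, G j) (fun i _ j _ hij => hGF i j hij)
        (fun i hi => IsCoprime.prod_right fun j hj => hG i j (hs i hi j hj)) ?_ hi
      exact Dvd.intro _ (by rw [← hx, mul_comm])
    · refine dvd_of_prod_dvd_mul_prod s₂ (H := ∏ j ∈ s₁, G j) (fun i _ j _ hij => hGF i j hij)
        (fun i hi => IsCoprime.prod_right fun j hj => hG i j (Ne.symm (hs j hj i hi))) ?_ hi
      exact Dvd.intro (∏ j ∈ s₁, F j) (by rw [mul_comm, hx, mul_comm])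

/-- **Uniqueness of Weil factorisations** (the clause "à coefficients entiers indépendants de
`ℓ`" of Deligne, *Weil I*, Théorème (1.6), and its proof on p. 277: "La description ci-dessus des
racines de `Pᵢ(t)` est indépendante de `ℓ`; le polynôme `Pᵢ(t)` lui-même est donc indépendant de
`ℓ`"). For `q > 1`, a power series `Z ∈ ℚ⟦T⟧` has at most one Weil factorisation
`(P₀, …, P₂ₙ)`: if `Z · ∏_{even} Pᵢ = ∏_{odd} Pᵢ` and `Z · ∏_{even} P'ᵢ = ∏_{odd} P'ᵢ` with
`Pᵢ(0) = P'ᵢ(0) = 1` and all complex roots of `Pᵢ`, `P'ᵢ` of absolute value `q^{-i/2}`, then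
`∏_{odd} Pᵢ · ∏_{even} P'ⱼ = ∏_{odd} P'ᵢ · ∏_{even} Pⱼ`, polynomials with different indices are
coprime (their roots lie on different circles), so `Pᵢ ∣ P'ᵢ ∣ Pᵢ` and `Pᵢ = P'ᵢ`.
[cite: Deligne1974, Thm. (1.6) and p. 277] -/
theorem _root_.Literature.AlgebraicGeometry.Motives.IsWeilFactorization.unique {q n : ℕ}
    (hq : 1 < q) {Z : PowerSeries ℚ} {P P' : Fin (2 * n + 1) → ℤ[X]}
    (h : IsWeilFactorization q n Z P) (h' : IsWeilFactorization q n Z P') : P = P' := by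
  classical
  obtain ⟨h0, hZ, -, -, hRH⟩ := h
  obtain ⟨h0', hZ', -, -, hRH'⟩ := h'
  -- any two of the polynomials with different indices are coprime over `ℚ`
  have hcop : ∀ {A B : Fin (2 * n + 1) → ℤ[X]},
      (∀ i (z : ℂ), ((A i).map (Int.castRingHom ℂ)).IsRoot z →
        ‖z‖ = (q : ℝ) ^ (-((i : ℕ) : ℝ) / 2)) →
      (∀ i (z : ℂ), ((B i).map (Int.castRingHom ℂ)).IsRoot z →
        ‖z‖ = (q : ℝ) ^ (-((i : ℕ) : ℝ) / 2)) →
      ∀ i j, i ≠ j →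
        IsCoprime ((A i).map (Int.castRingHom ℚ)) ((B j).map (Int.castRingHom ℚ)) := by
    intro A B hA hB i j hij
    refine isCoprime_of_norm_roots (fun e => hij (Fin.ext (eq_of_rpow_neg_half_eq hq e)))
      (fun z hz => hA i z ?_) (fun z hz => hB j z ?_)
    · rwa [map_map_int_rat_complex] at hz
    · rwa [map_map_int_rat_complex] at hz
  -- cross-multiplication: `∏_{odd} Pᵢ · ∏_{even} P'ⱼ = ∏_{odd} P'ᵢ · ∏_{even} Pⱼ`
  have hx : (∏ i ∈ (Finset.univ : Finset (Fin (2 * n + 1))) with Odd i.val,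
        (P i).map (Int.castRingHom ℚ)) *
      (∏ i ∈ (Finset.univ : Finset (Fin (2 * n + 1))) with Even i.val,
        (P' i).map (Int.castRingHom ℚ)) =
      (∏ i ∈ (Finset.univ : Finset (Fin (2 * n + 1))) with Odd i.val,
        (P' i).map (Int.castRingHom ℚ)) *
      ∏ i ∈ (Finset.univ : Finset (Fin (2 * n + 1))) with Even i.val,
        (P i).map (Int.castRingHom ℚ) := by
    apply Polynomial.coe_injective
    rw [Polynomial.coe_mul, Polynomial.coe_mul, WeilFunctionalEquation.coe_prod,
      WeilFunctionalEquation.coe_prod, WeilFunctionalEquation.coe_prod,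
      WeilFunctionalEquation.coe_prod, ← hZ, ← hZ']
    ring
  funext i
  apply Polynomial.map_injective (Int.castRingHom ℚ) Int.cast_injective
  refine eq_of_prod_mul_prod_eq _ _ (hcop hRH hRH') (hcop hRH hRH) (hcop hRH' hRH')
    (fun i hi j hj hij => (Nat.not_even_iff_odd.mpr (Finset.mem_filter.mp hi).2)
      (hij ▸ (Finset.mem_filter.mp hj).2)) hx
    (fun i => by rw [coeff_map, coeff_map, h0 i, h0' i])
    (fun i => by rw [coeff_map, h0' i, eq_intCast, Int.cast_one]; exact one_ne_zero) ?_
  rcases Nat.even_or_odd i.val with he | ho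
  · exact Or.inr (Finset.mem_filter.mpr ⟨Finset.mem_univ _, he⟩)
  · exact Or.inl (Finset.mem_filter.mpr ⟨Finset.mem_univ _, ho⟩)

end Unique

end WeilDeligneReduction

/-! ### Deligne's reduction for a Galois Weil cohomology theory -/

section Cohomology

open CategoryTheory _root_.AlgebraicGeometry WeilDeligneReduction
open Literature.AlgebraicGeometry.Motives (GaloisWeilCohomology SchemeOver IsSmoothProjective
  IsWeilFactorization zetaSeries arithFrob padicCyclotomicCharacter)

variable {k : Type u} [Field k] [Finite k] {K : Type v} [Field K] [CharZero K]
  {χ : Field.absoluteGaloisGroup k →* Kˣ} (E : GaloisWeilCohomology k K χ)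

/-- **Deligne's reduction (1.7) ⟹ (1.6)** (Deligne, *La conjecture de Weil. I*, Publ. Math.
IHÉS 43 (1974), pp. 276–277), for a Galois Weil cohomology theory `E` over the finite field `k`
(`q = #k`) with coefficients in a field `K` of characteristic zero, satisfying the Lefschetz trace
formula, and a smooth projective `X` of dimension `n`. **Hypothesis (Lemma (1.7), eigenvalue-free
form):** for each `i ≤ 2n` the polynomial `Pᵢ(T) = det(1 - T·F | Hⁱ(X))` divides, in `K[T]`, the
image of a polynomial `Rᵢ ∈ ℚ[T]` all of whose complex roots have absolute value `q^{-i/2}`.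
(This is equivalent to (1.7) as printed — "les valeurs propres de `F*` sur `Hⁱ` sont des nombres
algébriques dont tous les conjugués complexes `α` sont de valeur absolue `q^{i/2}`": take for
`Rᵢ` the product of the reversed minimal polynomials over `ℚ` of the eigenvalues; conversely every
eigenvalue `α` has `Rᵢ(α⁻¹) = 0`.) **Conclusion (Theorem (1.6)):** `E.WeilRiemannHypothesisFor X n`
— each `Pᵢ` has an integral model `Pᵢ ∈ ℤ[T]` all of whose complex roots have absolute value
`q^{-i/2}`. Proof: `Z(X, T) ∈ ℤ⟦T⟧` (`WeilFatou.exists_int_map_eq_zetaSeries_of_isSmoothProjective`),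
`Z · ∏_{even} Pᵢ = ∏_{odd} Pᵢ` (`zetaSeries_mul_prod_frobCharPoly_holds`, (1.5.4)), the `Rᵢ` are
pairwise coprime (roots of different absolute values, `q > 1`), and the abstract reduction
`WeilDeligneReduction.exists_int_model` (rationality descent, Fatou, Gauss) applies; the roots of
the integral model of `Pᵢ` are roots of `Rᵢ`. [cite: Deligne1974, Lemme (1.7) ⟹ Théorème (1.6), pp. 276–277] -/
theorem weilRiemannHypothesisFor_of_frobCharPoly_dvd (hE : E.HasLefschetzTraceFormula) {n : ℕ}
    {Y : SchemeOver k} (hX : IsSmoothProjective n Y)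
    (h : ∀ i ≤ 2 * n, ∃ R : ℚ[X], E.frobCharPoly Y i ∣ R.map (algebraMap ℚ K) ∧
      ∀ z : ℂ, (R.map (algebraMap ℚ ℂ)).IsRoot z → ‖z‖ = (Nat.card k : ℝ) ^ (-(i : ℝ) / 2)) :
    E.WeilRiemannHypothesisFor Y n := by
  classical
  choose! R hRd hRz using h
  have hq : 1 < Nat.card k := Finite.one_lt_card
  have hmem : ∀ {i}, i ∈ Finset.range (2 * n + 1) → i ≤ 2 * n := fun hi =>
    Nat.lt_succ_iff.mp (Finset.mem_range.mp hi)
  have hZP := E.zetaSeries_mul_prod_frobCharPoly_holds hE hX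
  rw [← WeilFunctionalEquation.coe_prod, ← WeilFunctionalEquation.coe_prod] at hZP
  obtain ⟨Zℤ, -, hZℤ⟩ := WeilFatou.exists_int_map_eq_zetaSeries_of_isSmoothProjective hX
  have main : ∀ i ∈ Finset.range (2 * n + 1), ∃ Q : ℤ[X],
      Q.map (Int.castRingHom K) = E.frobCharPoly Y i ∧ Q.map (Int.castRingHom ℚ) ∣ R i :=
    fun i hi => exists_int_model ⟨Zℤ, hZℤ⟩
      (Literature.AlgebraicGeometry.Motives.constantCoeff_zetaSeries Y) (2 * n + 1)
      (fun i _ => E.coeff_zero_frobCharPoly Y i) hZP (fun i hi => hRd i (hmem hi))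
      (fun i hi j hj hij => isCoprime_of_norm_roots
        (fun h => hij (eq_of_rpow_neg_half_eq hq h)) (hRz i (hmem hi)) (hRz j (hmem hj))) hi
  choose! Q hQK hQR using main
  refine ⟨fun i => Q i, fun i => hQK i (Finset.mem_range.mpr i.2), fun i z hz =>
    hRz i (Nat.lt_succ_iff.mp i.2) z ?_⟩
  have hdvd : (Q i).map (Int.castRingHom ℂ) ∣ (R i).map (algebraMap ℚ ℂ) := by
    have h := Polynomial.map_dvd (algebraMap ℚ ℂ) (hQR i (Finset.mem_range.mpr i.2))
    rwa [Polynomial.map_map, (RingHom.ext_int _ _ :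
      (algebraMap ℚ ℂ).comp (Int.castRingHom ℚ) = Int.castRingHom ℂ)] at h
  exact hz.dvd hdvd

/-- **Lemma (1.7) as printed, for `E`, implies its eigenvalue-free form** (Deligne, *Weil I*,
Lemme (1.7)): if every eigenvalue `α` of the geometric Frobenius on `Hⁱ(X)` — every root, in an
algebraically closed extension `L` of `K`, of the characteristic polynomial of `E.frobAction X i` —
is algebraic over `ℚ` with all complex conjugates of absolute value `q^{i/2}`, then
`det(1 - T·F | Hⁱ(X))` divides the image of a polynomial `R ∈ ℚ[T]` all of whose complex roots
have absolute value `q^{-i/2}` (`WeilDeligneReduction.exists_reverse_dvd_of_roots`).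
[cite: Deligne1974, Lemme (1.7)] -/
theorem frobCharPoly_dvd_of_eigenvalues {L : Type*} [Field L] [CharZero L] [Algebra K L]
    [IsAlgClosed L] {n : ℕ} {Y : SchemeOver k} (hX : IsSmoothProjective n Y) (i : ℕ)
    (h : ∀ α : L, ((haveI := E.finite_obj hX i; (E.frobAction Y i).charpoly).map
        (algebraMap K L)).IsRoot α → IsIntegral ℚ α ∧
      ∀ z : ℂ, ((minpoly ℚ α).map (algebraMap ℚ ℂ)).IsRoot z → ‖z‖ = (Nat.card k : ℝ) ^ ((i : ℝ) / 2)) :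
    ∃ R : ℚ[X], E.frobCharPoly Y i ∣ R.map (algebraMap ℚ K) ∧
      ∀ z : ℂ, (R.map (algebraMap ℚ ℂ)).IsRoot z → ‖z‖ = (Nat.card k : ℝ) ^ (-(i : ℝ) / 2) := by
  haveI := E.finite_obj hX i
  obtain ⟨R, hR, hz⟩ := exists_reverse_dvd_of_roots (E.frobAction Y i).charpoly_monic h
  refine ⟨R, by rwa [E.frobCharPoly_of_finite], fun z hz' => ?_⟩
  rw [hz z hz', neg_div, Real.rpow_neg (Nat.cast_nonneg _)]

/-- **Deligne's reduction (1.7) ⟹ (1.6), with (1.7) as printed** (Deligne, *Weil I*,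
pp. 276–277): for `E` with the Lefschetz trace formula and `X` smooth projective of dimension `n`,
if for every `i ≤ 2n` the eigenvalues of the geometric Frobenius on `Hⁱ(X)` (roots in an
algebraically closed `L ⊇ K` of the characteristic polynomial) are algebraic numbers all of whose
complex conjugates have absolute value `q^{i/2}`, then `E.WeilRiemannHypothesisFor X n`: the
`det(1 - T·F | Hⁱ(X))` have integer coefficients and complex roots of absolute value `q^{-i/2}`.
[cite: Deligne1974, Lemme (1.7) ⟹ Théorème (1.6), pp. 276–277] -/
theorem weilRiemannHypothesisFor_of_eigenvalues {L : Type*} [Field L] [CharZero L] [Algebra K L]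
    [IsAlgClosed L] (hE : E.HasLefschetzTraceFormula) {n : ℕ} {Y : SchemeOver k}
    (hX : IsSmoothProjective n Y)
    (h : ∀ i ≤ 2 * n, ∀ α : L, ((haveI := E.finite_obj hX i; (E.frobAction Y i).charpoly).map
        (algebraMap K L)).IsRoot α → IsIntegral ℚ α ∧
      ∀ z : ℂ, ((minpoly ℚ α).map (algebraMap ℚ ℂ)).IsRoot z → ‖z‖ = (Nat.card k : ℝ) ^ ((i : ℝ) / 2)) :
    E.WeilRiemannHypothesisFor Y n :=
  weilRiemannHypothesisFor_of_frobCharPoly_dvd E hE hX fun i hi =>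
    frobCharPoly_dvd_of_eigenvalues E hX i (h i hi)

/-- **Independence of the cohomology theory** (Deligne, *Weil I*, Théorème (1.6): "à coefficients
entiers indépendants de `ℓ`"; p. 277). Let `E`, `E'` be two Galois Weil cohomology theories over
the finite field `k` (possibly with different coefficient fields, e.g. `ℓ`-adic and `ℓ'`-adic
cohomology), both satisfying the Lefschetz trace formula and `χ(φ) = q`, and let `X` be smooth
projective of dimension `n`. If `(Pᵢ)` are integral models of the `det(1 - T·F | Hⁱ(X))` for `E`
and `(P'ᵢ)` for `E'`, both satisfying the Riemann hypothesis (all complex roots of absolute value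
`q^{-i/2}`), then `Pᵢ = P'ᵢ` for all `i`: both are Weil factorisations of the same `Z(X, T)`
(`isWeilFactorization_of_isIntegralModel`), which are unique (`IsWeilFactorization.unique`).
[cite: Deligne1974, Thm. (1.6) and p. 277] -/
theorem integralModel_eq_of_weilRiemannHypothesis {K' : Type*} [Field K'] [CharZero K']
    {χ' : Field.absoluteGaloisGroup k →* K'ˣ} (E' : GaloisWeilCohomology k K' χ')
    (hE : E.HasLefschetzTraceFormula) (hχ : (χ (arithFrob k) : K) = Nat.card k)
    (hE' : E'.HasLefschetzTraceFormula) (hχ' : (χ' (arithFrob k) : K') = Nat.card k)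
    {n : ℕ} {Y : SchemeOver k} (hX : IsSmoothProjective n Y) {P P' : Fin (2 * n + 1) → ℤ[X]}
    (hP : ∀ i : Fin (2 * n + 1), E.IsIntegralModel Y i (P i))
    (hRH : ∀ (i : Fin (2 * n + 1)) (z : ℂ), ((P i).map (Int.castRingHom ℂ)).IsRoot z →
      ‖z‖ = (Nat.card k : ℝ) ^ (-((i : ℕ) : ℝ) / 2))
    (hP' : ∀ i : Fin (2 * n + 1), E'.IsIntegralModel Y i (P' i))
    (hRH' : ∀ (i : Fin (2 * n + 1)) (z : ℂ), ((P' i).map (Int.castRingHom ℂ)).IsRoot z →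
      ‖z‖ = (Nat.card k : ℝ) ^ (-((i : ℕ) : ℝ) / 2)) :
    P = P' :=
  (isWeilFactorization_of_isIntegralModel E hE hχ hX hP hRH).unique Finite.one_lt_card
    (isWeilFactorization_of_isIntegralModel E' hE' hχ' hX hP' hRH')

/-- **Deligne's theorem (1.6) for `E` from Lemma (1.7) for `E`** (Deligne, *Weil I*,
pp. 276–277): if the Galois Weil cohomology theory `E` satisfies the Lefschetz trace formula and,
for every smooth projective `X` and `i ≤ 2 dim X`, `det(1 - T·F | Hⁱ(X))` divides the image of a
rational polynomial all of whose complex roots have absolute value `q^{-i/2}` (Lemma (1.7) in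
eigenvalue-free form), then `DeligneWeilIStatement E` holds.
[cite: Deligne1974, Lemme (1.7) ⟹ Théorème (1.6), pp. 276–277] -/
theorem deligneWeilIStatement_of_frobCharPoly_dvd (hE : E.HasLefschetzTraceFormula)
    (h : ∀ ⦃n : ℕ⦄ ⦃Y : SchemeOver k⦄, IsSmoothProjective n Y → ∀ i ≤ 2 * n, ∃ R : ℚ[X],
      E.frobCharPoly Y i ∣ R.map (algebraMap ℚ K) ∧
        ∀ z : ℂ, (R.map (algebraMap ℚ ℂ)).IsRoot z → ‖z‖ = (Nat.card k : ℝ) ^ (-(i : ℝ) / 2)) :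
    DeligneWeilIStatement E :=
  fun _ _ hX => weilRiemannHypothesisFor_of_frobCharPoly_dvd E hE hX (h hX)

/-- **The Weil conjectures for `Z(X, T)` from the cohomological formalism and Deligne's Lemma
(1.7)** (Deligne, *Weil I*: (1.5.4), (1.7) ⟹ (1.6), (2.5)(c)). Let `E` be a Galois Weil
cohomology theory over the finite field `k` satisfying the Lefschetz trace formula, with
`χ(φ) = q`, and such that for every smooth projective `X` and `i ≤ 2 dim X` the polynomial
`det(1 - T·F | Hⁱ(X))` divides the image of some `Rᵢ ∈ ℚ[T]` all of whose complex roots have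
absolute value `q^{-i/2}` (Lemma (1.7)). Then `exists_isWeilFactorization` holds over `k`
(`exists_isWeilFactorization_of_galoisWeilCohomology` with
`deligneWeilIStatement_of_frobCharPoly_dvd`). [cite: Deligne1974, (1.7), Thm. (1.6)] -/
theorem exists_isWeilFactorization_of_frobCharPoly_dvd (E : GaloisWeilCohomology k K χ)
    (hE : E.HasLefschetzTraceFormula) (hχ : (χ (arithFrob k) : K) = Nat.card k)
    (h : ∀ ⦃n : ℕ⦄ ⦃Y : SchemeOver k⦄, IsSmoothProjective n Y → ∀ i ≤ 2 * n, ∃ R : ℚ[X],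
      E.frobCharPoly Y i ∣ R.map (algebraMap ℚ K) ∧
        ∀ z : ℂ, (R.map (algebraMap ℚ ℂ)).IsRoot z → ‖z‖ = (Nat.card k : ℝ) ^ (-(i : ℝ) / 2)) :
    exists_isWeilFactorization (k := k) :=
  exists_isWeilFactorization_of_galoisWeilCohomology E hE hχ
    (deligneWeilIStatement_of_frobCharPoly_dvd E hE h)

/-- **The Weil conjectures for `Z(X, T)`, granted `ℓ`-adic cohomology with the trace formula and
Deligne's Lemma (1.7).** If for every prime `ℓ` invertible in `k` there is a Galois Weil
cohomology theory with `ℚ_ℓ`-coefficients and cyclotomic twist satisfying the Lefschetz trace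
formula (Grothendieck, SGA 4, 4½, 5) and Lemma (1.7) of Deligne's *Weil I* (the eigenvalues of
Frobenius on `Hⁱ` are algebraic with all complex conjugates of absolute value `q^{i/2}`, in the
eigenvalue-free form above) — as `ℓ`-adic étale cohomology does (Deligne 1974, §§3–7) — then
`exists_isWeilFactorization` holds over `k`. Compared with
`exists_isWeilFactorization_of_forall_prime`, the unproved input is Deligne's (1.7) rather than
his (1.6): the step (1.7) ⟹ (1.6) is now proved. [cite: Deligne1974, Lemme (1.7)] -/
theorem exists_isWeilFactorization_of_forall_prime_of_frobCharPoly_dvd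
    (h : ∀ (ℓ : ℕ) [Fact ℓ.Prime], (ℓ : k) ≠ 0 →
      ∃ E : GaloisWeilCohomology k ℚ_[ℓ] (padicCyclotomicCharacter k ℓ),
        E.HasLefschetzTraceFormula ∧
        ∀ ⦃n : ℕ⦄ ⦃Y : SchemeOver k⦄, IsSmoothProjective n Y → ∀ i ≤ 2 * n, ∃ R : ℚ[X],
          E.frobCharPoly Y i ∣ R.map (algebraMap ℚ ℚ_[ℓ]) ∧
            ∀ z : ℂ, (R.map (algebraMap ℚ ℂ)).IsRoot z →
              ‖z‖ = (Nat.card k : ℝ) ^ (-(i : ℝ) / 2)) :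
    exists_isWeilFactorization (k := k) :=
  exists_isWeilFactorization_of_forall_prime fun ℓ _ hℓ => by
    obtain ⟨E, hE, h17⟩ := h ℓ hℓ
    exact ⟨E, hE, deligneWeilIStatement_of_frobCharPoly_dvd E hE h17⟩

end Cohomology

end Literature.NumberTheory.LFunctions

end
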